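import Mathlib

/-!
# Crux V2♭θ `KolyvaginCorankLowerBoundAtTwoTheta` (stmt-BirchSwinnertonDyer-27220), line
# `kolyvagin_depth_split`, inside of S1 (Kolyvagin's prime swap at `2`): the PAIRING-ORDER pieces
# P7a / P7b of the lead's `S1-PLAN.md`, ABSTRACT PART — eigen-line algebra of a `τ`-invariant
# bi-additive pairing of finite abelian `2`-groups (helper, PROVED, Mathlib-only; width seat
# `bsd-line-krr2-p2` g6)

At a Kolyvagin prime `v` for the level `2^M` the local Tate pairing
`f : H¹(K_v, E[2^M]) × H¹(K_v, E[2^M]^D) → ℤ/2^M` is invariant under the non-trivial automorphism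
`τ` of `K` (`f (τ a) (τ b) = f a b`), the unramified (Kummer) part `Kum_v ≅ E[2^M]` carries the
action of complex conjugation `τ_E` and the singular quotient carries `-τ_E^D`.  At `p = 2` the
`s`-eigen-subgroups (`s = ±1`) of these rank-two `ℤ/2^M`-modules are NOT free of rank one: they
are `ℤ/2^M ⊕ ℤ/2` when `Δ_E > 0` (and `ℤ/2^M` when `Δ_E < 0`).  This file isolates the pure
group theory that nevertheless gives Kolyvagin's pairing-order bounds with a loss of a bounded
number of bits:

* `two_smul_pairing_eq_zero_of_opposite` — opposite-sign eigenvectors pair into the `2`-torsion;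
* `exists_eq_zsmul_add_of_card_le` (+ `AddSubgroup` wrapper) — a `2^M`-torsion group of order
  `≤ 2^{M+1}` with an element `g` of order `2^M` is `ℤ g + (2-torsion)` (the eigen-"line" at `2`);
* `pow_smul_pairing_ne_zero_of_eigen` — **abstract P7a** (LOWER bound, constant `3`): for
  `s`-eigenvectors `x ∈ K ≤ A`, `y ∈ B` (modulo an `f|_K`-null subgroup `N ≤ B`),
  `2^i x ≠ 0 → 2^j y ∉ N → M + 3 ≤ i + j + 1 → 2^{i+j+1-M-3} • f x y ≠ 0`, given the line
  structure of the eigen-parts and ONE witness `b₀` with `2^{M-1} • f g b₀ ≠ 0` (non-degeneracy);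
* `pow_smul_pairing_eq_zero_of_split` — **abstract P7b** (UPPER bound, constant `0`): if
  `A = K + T` with `K ∩ T = 0`, `K` is `2^M`-homogeneous, `f T y = 0` and `2^b` kills `f K y`, then
  `2^a x ∈ T → 2^{a+b-M} • f x y = 0`.

The instantiation (Kummer part at a Kolyvagin prime of index `≥ M`, transverse part, Weil-dual
intertwining, `τ = conjActPlace`) is a separate file; nothing here mentions elliptic curves.
HONEST FRAMING: helper lemmas (`--supports`); S1 / V2♭θ are NOT proved; BSD is not proved by
any of this.

References: [Kolyvagin1991MathAnn] §2 (the reciprocity step of the induction, `p` arbitrary);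
[McCallumLMS1991] §§3–4 (local pairings at Kolyvagin primes); folklore linear algebra at `2`.
-/

set_option autoImplicit false
-- the Theorems namespace of this sub repeats the summit name by design (D-0017 nested layout)
set_option linter.dupNamespace false

namespace Summit.BirchSwinnertonDyer.BirchSwinnertonDyer.Theorems.KolyvaginLowerBoundAtTwo.SwapPairing

variable {A B C : Type*} [AddCommGroup A] [AddCommGroup B] [AddCommGroup C]

/-! ## Arithmetic of `2`-power multiples -/

/-- If `2^M • z = 0` and `z ≠ 0`, an odd multiple of `z` is non-zero (odd integers are units
modulo `2^M`). [folklore] -/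
theorem zsmul_ne_zero_of_odd {M : ℕ} {z : C} (hzM : (2 : ℤ) ^ M • z = 0) {u : ℤ} (hu : Odd u)
    (hz : z ≠ 0) : u • z ≠ 0 := by
  have hcop : IsCoprime u ((2 : ℤ) ^ M) := by
    apply IsCoprime.pow_right
    rw [Int.isCoprime_iff_gcd_eq_one]
    rcases hu with ⟨k, rfl⟩
    simp [Int.gcd]
  obtain ⟨a, b, hab⟩ := hcop
  intro h0
  apply hz
  calc z = (a * u + b * 2 ^ M) • z := by rw [hab, one_smul]
    _ = a • (u • z) + b • ((2 : ℤ) ^ M • z) := by rw [add_smul, mul_smul, mul_smul]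
    _ = 0 := by rw [h0, hzM, smul_zero, smul_zero, add_zero]

/-- `2^i • (α • g) ∉ N` with `2^M • g ∈ N` (a subgroup) forces `α = 2^a • (odd)` with `a + i < M`.
[folklore] -/
theorem exists_odd_of_pow_smul_zsmul_notMem {M : ℕ} (N : AddSubgroup A) {g : A}
    (hg : (2 : ℤ) ^ M • g ∈ N) {α : ℤ} {i : ℕ} (h : (2 : ℤ) ^ i • (α • g) ∉ N) :
    ∃ (a : ℕ) (u : ℤ), Odd u ∧ α = 2 ^ a * u ∧ a + i < M := by
  have hα0 : α ≠ 0 := by rintro rfl; exact h (by rw [zero_smul, smul_zero]; exact N.zero_mem)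
  obtain ⟨a, m, hm, ham⟩ := Nat.exists_eq_two_pow_mul_odd (Int.natAbs_ne_zero.mpr hα0)
  -- `α = ± 2^a m`
  have hα : α = 2 ^ a * (Int.sign α * m) := by
    have h1 : (α.natAbs : ℤ) = 2 ^ a * m := by rw [ham]; push_cast; ring
    calc α = Int.sign α * (α.natAbs : ℤ) := (Int.sign_mul_natAbs α).symm
      _ = 2 ^ a * (Int.sign α * m) := by rw [h1]; ring
  refine ⟨a, Int.sign α * m, ?_, hα, ?_⟩
  · have hs : Int.sign α = 1 ∨ Int.sign α = -1 := by
      rcases lt_trichotomy α 0 with hl | rfl | hg'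
      · exact Or.inr (Int.sign_eq_neg_one_of_neg hl)
      · exact absurd rfl hα0
      · exact Or.inl (Int.sign_eq_one_of_pos hg')
    have hmodd : Odd (m : ℤ) := by exact_mod_cast hm
    rcases hs with hs | hs <;> rw [hs]
    · simpa using hmodd
    · simpa using hmodd.neg
  · by_contra hle
    push Not at hle
    apply h
    obtain ⟨d, hd⟩ : ∃ d, a + i = d + M := ⟨a + i - M, by omega⟩
    have : (2 : ℤ) ^ i * α = (Int.sign α * m) * 2 ^ d * 2 ^ M := by
      conv_lhs => rw [hα]
      calc (2 : ℤ) ^ i * (2 ^ a * (Int.sign α * ↑m)) = 2 ^ (a + i) * (Int.sign α * ↑m) := by ring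
        _ = _ := by rw [hd, pow_add]; ring
    rw [smul_smul, this, mul_smul]
    exact N.zsmul_mem hg _

/-- `2^i • (α • g) ≠ 0` with `2^M • g = 0` forces `α = 2^a • (odd)` with `a + i < M`. [folklore] -/
theorem exists_odd_of_pow_smul_zsmul_ne_zero {M : ℕ} {g : A} (hg : (2 : ℤ) ^ M • g = 0) {α : ℤ}
    {i : ℕ} (h : (2 : ℤ) ^ i • (α • g) ≠ 0) :
    ∃ (a : ℕ) (u : ℤ), Odd u ∧ α = 2 ^ a * u ∧ a + i < M :=
  exists_odd_of_pow_smul_zsmul_notMem (⊥ : AddSubgroup A) (by rw [hg]; exact AddSubgroup.zero_mem _)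
    (by rwa [AddSubgroup.mem_bot])

/-! ## The eigen-"line" at `2`: a `2^M`-torsion group of order `≤ 2^{M+1}` with an element of
order `2^M` -/

/-- **Line decomposition from a count.** A finite abelian group `G` killed by `2^M`, of order
`≤ 2^{M+1}`, with an element `g` of order `2^M` (`2^{M-1} • g ≠ 0`), is `ℤ g + G[2]`: every `x` is
`c • g + t` with `2 • t = 0`.  (At `p = 2` this replaces "the `s`-eigenspace is free of rank one".)
[folklore] -/
theorem exists_eq_zsmul_add_of_card_le {G : Type*} [AddCommGroup G] [Finite G] {M : ℕ} (hM : 1 ≤ M)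
    (hcard : Nat.card G ≤ 2 ^ (M + 1)) (hexp : ∀ x : G, (2 : ℤ) ^ M • x = 0)
    {g : G} (hg : (2 : ℤ) ^ (M - 1) • g ≠ 0) (x : G) :
    ∃ (c : ℤ) (t : G), (2 : ℤ) • t = 0 ∧ x = c • g + t := by
  -- the order of `g` is `2^M`
  have hord : addOrderOf g = 2 ^ M := by
    obtain ⟨M', rfl⟩ : ∃ M', M = M' + 1 := ⟨M - 1, by omega⟩
    apply addOrderOf_eq_prime_pow
    · rw [show M' + 1 - 1 = M' by omega] at hg
      rwa [← natCast_zsmul, Nat.cast_pow, Nat.cast_ofNat]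
    · rw [← natCast_zsmul, Nat.cast_pow, Nat.cast_ofNat]; exact hexp g
  set L := AddSubgroup.zmultiples g with hL
  have hcardL : Nat.card L = 2 ^ M := by rw [hL, Nat.card_zmultiples, hord]
  -- `[G : L] ≤ 2`
  have hmul : Nat.card L * L.index = Nat.card G := L.card_mul_index
  have hidx_pos : 0 < L.index := Nat.pos_of_ne_zero L.index_ne_zero_of_finite
  have hidx : L.index ≤ 2 := by
    by_contra hlt
    push Not at hlt
    have h3 : 2 ^ M * 3 ≤ 2 ^ M * 2 := by
      calc 2 ^ M * 3 ≤ Nat.card L * L.index := by rw [hcardL]; exact Nat.mul_le_mul_left _ hlt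
        _ = Nat.card G := hmul
        _ ≤ 2 ^ M * 2 := by rw [← pow_succ]; exact hcard
    have := Nat.le_of_mul_le_mul_left h3 (by positivity)
    omega
  have hmem : (L.index : ℤ) • x ∈ L := by rw [natCast_zsmul]; exact L.nsmul_index_mem x
  interval_cases hL' : L.index
  · -- index `1`: `x ∈ L`
    rw [Nat.cast_one, one_smul, hL, AddSubgroup.mem_zmultiples_iff] at hmem
    obtain ⟨c, hc⟩ := hmem
    exact ⟨c, 0, smul_zero _, by rw [hc, add_zero]⟩
  · -- index `2`: `2 • x = c • g`, and `c` must be even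
    rw [Nat.cast_ofNat, hL, AddSubgroup.mem_zmultiples_iff] at hmem
    obtain ⟨c, hc⟩ := hmem
    rcases Int.even_or_odd c with ⟨c', hc'⟩ | hodd
    · refine ⟨c', x - c' • g, ?_, by abel⟩
      rw [smul_sub, ← hc, hc', add_smul, two_smul]; abel
    · -- `2^M • x = 2^{M-1} • (c • g) = c • (2^{M-1} • g) ≠ 0`, contradiction
      exfalso
      have h1 : (2 : ℤ) ^ M • x = c • ((2 : ℤ) ^ (M - 1) • g) := by
        rw [show M = (M - 1) + 1 by omega, pow_succ, mul_smul, ← hc, smul_comm,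
          show M - 1 + 1 - 1 = M - 1 by omega]
      have h2 : (2 : ℤ) ^ M • ((2 : ℤ) ^ (M - 1) • g) = 0 := by
        rw [smul_comm, hexp, smul_zero]
      exact zsmul_ne_zero_of_odd h2 hodd hg (h1 ▸ hexp x)

/-- `AddSubgroup` form of `exists_eq_zsmul_add_of_card_le`: for a finite subgroup `S` of order
`≤ 2^{M+1}` killed by `2^M` and `g ∈ S` with `2^{M-1} • g ≠ 0`, every `x ∈ S` is `c • g + t` with
`t ∈ S`, `2 • t = 0`. [folklore] -/
theorem exists_eq_zsmul_add_of_card_le_of_mem {G : Type*} [AddCommGroup G] {M : ℕ} (hM : 1 ≤ M)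
    (S : AddSubgroup G) (hfin : (S : Set G).Finite) (hcard : Nat.card S ≤ 2 ^ (M + 1))
    (hexp : ∀ x ∈ S, (2 : ℤ) ^ M • x = 0) {g : G} (hgS : g ∈ S) (hg : (2 : ℤ) ^ (M - 1) • g ≠ 0)
    {x : G} (hx : x ∈ S) :
    ∃ (c : ℤ) (t : G), t ∈ S ∧ (2 : ℤ) • t = 0 ∧ x = c • g + t := by
  haveI : Finite S := hfin.to_subtype
  have hexp' : ∀ y : S, (2 : ℤ) ^ M • y = 0 := fun y ↦ Subtype.ext (by
    simpa using hexp y.1 y.2)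
  have hg' : (2 : ℤ) ^ (M - 1) • (⟨g, hgS⟩ : S) ≠ 0 := by
    intro h0
    apply hg
    simpa using congrArg Subtype.val h0
  obtain ⟨c, t, ht, hxt⟩ := exists_eq_zsmul_add_of_card_le hM hcard hexp' hg' ⟨x, hx⟩
  refine ⟨c, t.1, t.2, by simpa using congrArg Subtype.val ht, ?_⟩
  simpa using congrArg Subtype.val hxt

/-! ## Pairing algebra -/

/-- `2 • f x y = (2αβ) • f g h` for `x = α g + t₁`, `y = β h + t₂` with `2 t₁ = 0`, `2 t₂ ∈ N`,
where `g, t₁ ∈ K` and `f K N = 0`. [folklore] -/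
theorem two_smul_pairing_eq (f : A →+ B →+ C) (K : AddSubgroup A) (N : AddSubgroup B)
    (hN : ∀ a ∈ K, ∀ n ∈ N, f a n = 0)
    {g : A} (hgK : g ∈ K) {h : B} {x : A} {y : B} {α β : ℤ} {t₁ : A} {t₂ : B}
    (ht₁K : t₁ ∈ K) (ht₁ : (2 : ℤ) • t₁ = 0) (ht₂ : (2 : ℤ) • t₂ ∈ N)
    (hx : x = α • g + t₁) (hy : y = β • h + t₂) :
    (2 : ℤ) • f x y = (2 * α * β) • f g h := by
  subst hx hy
  have h1 : (2 : ℤ) • f t₁ (β • h) = 0 := by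
    rw [← AddMonoidHom.zsmul_apply, ← map_zsmul, ht₁, map_zero, AddMonoidHom.zero_apply]
  have h2 : (2 : ℤ) • f (α • g) t₂ = 0 := by
    rw [← map_zsmul]; exact hN _ (K.zsmul_mem hgK α) _ ht₂
  have h3 : (2 : ℤ) • f t₁ t₂ = 0 := by rw [← map_zsmul]; exact hN _ ht₁K _ ht₂
  have hmain : f (α • g) (β • h) = (α * β) • f g h := by
    simp only [map_zsmul, AddMonoidHom.zsmul_apply, smul_smul, mul_comm]
  simp only [map_add, AddMonoidHom.add_apply, smul_add, h1, h2, h3, add_zero, hmain, smul_smul]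
  ring_nf

/-- **Opposite-sign eigenvectors pair into the `2`-torsion.** If `f (τA a) (τB b) = f a b`,
`τA x = s x`, `τB y = -s y` (`s = ±1`) then `2 • f x y = 0`. [folklore] -/
theorem two_smul_pairing_eq_zero_of_opposite (f : A →+ B →+ C) (τA : A →+ A) (τB : B →+ B)
    (hτ : ∀ a b, f (τA a) (τB b) = f a b) {s : ℤ} (hs : s = 1 ∨ s = -1)
    {x : A} {y : B} (hx : τA x = s • x) (hy : τB y = -s • y) : (2 : ℤ) • f x y = 0 := by
  have h := hτ x y
  rw [hx, hy, map_zsmul, map_zsmul, AddMonoidHom.zsmul_apply, smul_smul] at h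
  have hss : -s * s = -1 := by rcases hs with rfl | rfl <;> norm_num
  rw [hss, neg_one_zsmul] at h
  rw [two_zsmul]
  nth_rewrite 1 [← h]
  exact neg_add_cancel _

/-- **The symmetrised test element.** From `b₀` with `2^k • (4 • f g b₀) ≠ 0` to a coefficient
`c` with `2^k • ((2c) • f g h) ≠ 0`, when every `s`-eigenvector of `τB` is `c • h + t` with
`2 • t ∈ N`, `f g N = 0`, `τA g = s g`, `τB` an involution and `f` `τ`-invariant. [folklore] -/
theorem exists_pow_smul_pairing_gen_ne_zero (f : A →+ B →+ C) (τA : A →+ A) (τB : B →+ B)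
    (hτ : ∀ a b, f (τA a) (τB b) = f a b) (hτB : ∀ b, τB (τB b) = b) {s : ℤ} (hs : s = 1 ∨ s = -1)
    (N : AddSubgroup B) {g : A} (hgN : ∀ n ∈ N, f g n = 0) {h : B} (hg : τA g = s • g)
    (hline : ∀ y : B, τB y = s • y → ∃ (c : ℤ) (t : B), (2 : ℤ) • t ∈ N ∧ y = c • h + t)
    {b₀ : B} {k : ℕ} (hb₀ : (2 : ℤ) ^ k • ((4 : ℤ) • f g b₀) ≠ 0) :
    ∃ c : ℤ, (2 : ℤ) ^ k • ((2 * c) • f g h) ≠ 0 := by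
  have hs2 : s * s = 1 := by rcases hs with rfl | rfl <;> norm_num
  set bp := b₀ + s • τB b₀ with hbp
  set bm := b₀ - s • τB b₀ with hbm
  have hbp_eig : τB bp = s • bp := by
    rw [hbp, map_add, map_zsmul, hτB, smul_add, smul_smul, hs2, one_smul, add_comm]
  have hbm_eig : τB bm = -s • bm := by
    rw [hbm, map_sub, map_zsmul, hτB, smul_sub, smul_smul, neg_mul, hs2]
    module
  have hwrong : (2 : ℤ) • f g bm = 0 :=
    two_smul_pairing_eq_zero_of_opposite f τA τB hτ hs hg hbm_eig
  have hsum : f g bp + f g bm = (2 : ℤ) • f g b₀ := by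
    have e : bp + bm = (2 : ℤ) • b₀ := by rw [hbp, hbm, two_zsmul]; abel
    rw [← map_add, e, map_zsmul]
  have hbp2 : (2 : ℤ) • f g bp = (4 : ℤ) • f g b₀ := by
    have e : (2 : ℤ) • f g bp = (2 : ℤ) • (f g bp + f g bm) - (2 : ℤ) • f g bm := by
      rw [smul_add, add_sub_cancel_right]
    rw [e, hwrong, sub_zero, hsum, smul_smul]; norm_num
  obtain ⟨c, t, ht, hct⟩ := hline bp hbp_eig
  refine ⟨c, fun h0 ↦ hb₀ ?_⟩
  have h2t : (2 : ℤ) • f g t = 0 := by rw [← map_zsmul]; exact hgN _ ht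
  have key : (4 : ℤ) • f g b₀ = (2 * c) • f g h := by
    rw [← hbp2, hct, map_add, map_zsmul, smul_add, h2t, add_zero, smul_smul]
  rw [key, h0]

/-- **Abstract P7a — lower bound for the pairing of two same-sign eigenvectors, constant `3`.**
Data: `f : A →+ B →+ C` with `f (τA a) (τB b) = f a b`, `τB` an involution, `s = ±1`; subgroups
`K ≤ A` (the Kummer part) and `N ≤ B` with `f K N = 0`; `2^M` kills `K`, `B/N` and `C`;
`g ∈ K` with `τA g = s g`; the `s`-eigenvectors of `K` are `ℤ g + K[2]` and those of `B` are
`ℤ h + {t | 2t ∈ N}`; one witness `b₀` with `2^{M-1} • f g b₀ ≠ 0`.  Then for `s`-eigenvectors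
`x ∈ K`, `y ∈ B`: `2^i • x ≠ 0 → 2^j • y ∉ N → M + 3 ≤ i + j + 1 → 2^{i+j+1-M-3} • f x y ≠ 0`.
[Kolyvagin1991MathAnn §2, the pairing-order estimate, at `p = 2`; folklore] -/
theorem pow_smul_pairing_ne_zero_of_eigen {M : ℕ} (f : A →+ B →+ C) (τA : A →+ A) (τB : B →+ B)
    (hτ : ∀ a b, f (τA a) (τB b) = f a b) (hτB : ∀ b, τB (τB b) = b) {s : ℤ} (hs : s = 1 ∨ s = -1)
    (K : AddSubgroup A) (N : AddSubgroup B) (hN : ∀ a ∈ K, ∀ n ∈ N, f a n = 0)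
    (hA : ∀ a ∈ K, (2 : ℤ) ^ M • a = 0) (hB : ∀ b : B, (2 : ℤ) ^ M • b ∈ N)
    (hC : ∀ c : C, (2 : ℤ) ^ M • c = 0)
    {g : A} (hgK : g ∈ K) (hg : τA g = s • g) {h : B}
    (hlineA : ∀ x ∈ K, τA x = s • x → ∃ (c : ℤ) (t : A), t ∈ K ∧ (2 : ℤ) • t = 0 ∧ x = c • g + t)
    (hlineB : ∀ y : B, τB y = s • y → ∃ (c : ℤ) (t : B), (2 : ℤ) • t ∈ N ∧ y = c • h + t)
    {b₀ : B} (hb₀ : (2 : ℤ) ^ (M - 1) • f g b₀ ≠ 0)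
    {x : A} (hxK : x ∈ K) {y : B} (hx : τA x = s • x) (hy : τB y = s • y) {i j : ℕ}
    (hi : (2 : ℤ) ^ i • x ≠ 0) (hj : (2 : ℤ) ^ j • y ∉ N) (hM : M + 3 ≤ i + j + 1) :
    (2 : ℤ) ^ (i + j + 1 - M - 3) • f x y ≠ 0 := by
  -- `i, j < M`
  have hjM : j < M := by
    by_contra hle; push Not at hle
    exact hj (by rw [show j = (j - M) + M by omega, pow_add, mul_smul]; exact N.zsmul_mem (hB y) _)
  have hiM : i < M := by
    by_contra hle; push Not at hle
    exact hi (by rw [show i = (i - M) + M by omega, pow_add, mul_smul, hA x hxK, smul_zero])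
  have hM3 : 3 ≤ M := by omega
  -- the generator pairing: `2^{M-2} • f g h ≠ 0`
  have hb₀' : (2 : ℤ) ^ (M - 3) • ((4 : ℤ) • f g b₀) ≠ 0 := by
    rwa [smul_smul, show (2 : ℤ) ^ (M - 3) * 4 = 2 ^ (M - 1) by
      rw [show (4 : ℤ) = 2 ^ 2 by norm_num, ← pow_add]; congr 1; omega]
  obtain ⟨c, hc⟩ := exists_pow_smul_pairing_gen_ne_zero f τA τB hτ hτB hs N
    (fun n hn ↦ hN g hgK n hn) hg hlineB hb₀'
  have hgh : (2 : ℤ) ^ (M - 2) • f g h ≠ 0 := by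
    intro h0
    apply hc
    rw [smul_smul, show (2 : ℤ) ^ (M - 3) * (2 * c) = c * 2 ^ (M - 2) by
      rw [show (M - 2) = (M - 3) + 1 by omega, pow_succ]; ring, mul_smul, h0, smul_zero]
  -- decompose `x`, `y`
  obtain ⟨α, t₁, ht₁K, ht₁, hxe⟩ := hlineA x hxK hx
  obtain ⟨β, t₂, ht₂, hye⟩ := hlineB y hy
  have h2 := two_smul_pairing_eq f K N hN hgK ht₁K ht₁ ht₂ hxe hye
  -- valuations of `α`, `β`
  have hiα : (2 : ℤ) ^ i • (α • g) ≠ 0 := by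
    intro h0; apply hi
    rcases Nat.eq_zero_or_pos i with rfl | hipos
    · exfalso; omega
    · rw [hxe, smul_add, h0, zero_add, show i = (i - 1) + 1 by omega, pow_succ, mul_smul, ht₁,
        smul_zero]
  have hjβ : (2 : ℤ) ^ j • (β • h) ∉ N := by
    intro h0; apply hj
    rcases Nat.eq_zero_or_pos j with rfl | hjpos
    · exfalso; omega
    · rw [hye, smul_add]
      refine N.add_mem h0 ?_
      rw [show (2 : ℤ) ^ j = 2 ^ (j - 1) * 2 by rw [← pow_succ]; congr 1; omega, mul_smul]
      exact N.zsmul_mem ht₂ _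
  obtain ⟨a, u, hu, hαe, ha⟩ := exists_odd_of_pow_smul_zsmul_ne_zero (hA g hgK) hiα
  obtain ⟨b, w, hw, hβe, hb⟩ := exists_odd_of_pow_smul_zsmul_notMem N (hB h) hjβ
  -- `2 • 2^{e} f x y = (u w) • 2^{e+1+a+b} f g h ≠ 0`
  intro h0
  have e1 : (2 : ℤ) • ((2 : ℤ) ^ (i + j + 1 - M - 3) • f x y) = 0 := by rw [h0, smul_zero]
  rw [smul_comm, h2, smul_smul, hαe, hβe] at e1
  have e2 : (2 : ℤ) ^ (i + j + 1 - M - 3) * (2 * (2 ^ a * u) * (2 ^ b * w)) =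
      (u * w) * 2 ^ (i + j + 1 - M - 3 + 1 + a + b) := by ring
  rw [e2, mul_smul] at e1
  have hne : (2 : ℤ) ^ (i + j + 1 - M - 3 + 1 + a + b) • f g h ≠ 0 := by
    intro h3
    apply hgh
    rw [show M - 2 = (M - 2 - (i + j + 1 - M - 3 + 1 + a + b)) + (i + j + 1 - M - 3 + 1 + a + b) by
      omega, pow_add, mul_smul, h3, smul_zero]
  have hkill : (2 : ℤ) ^ M • ((2 : ℤ) ^ (i + j + 1 - M - 3 + 1 + a + b) • f g h) = 0 := by
    rw [smul_comm, hC, smul_zero]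
  exact zsmul_ne_zero_of_odd hkill (hu.mul hw) hne e1

/-- **Abstract P7b — upper bound from a splitting, constant `0`.** If every `a : A` is `k + t`
with `k ∈ K`, `t ∈ T`, `K ∩ T = 0`, `K` is `2^M`-homogeneous (`2^a • k = 0 → k ∈ 2^{M-a} K` for
`a ≤ M`), `f T y = 0` and `2^b` kills `f K y`, then `2^a • x ∈ T → 2^{a+b-M} • f x y = 0`.
[Kolyvagin1991MathAnn §2, the transverse local condition, at `p = 2`; folklore] -/
theorem pow_smul_pairing_eq_zero_of_split {M : ℕ} (f : A →+ B →+ C) (K T : AddSubgroup A)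
    (hKT : ∀ a : A, ∃ k ∈ K, ∃ t ∈ T, a = k + t) (hdisj : ∀ a ∈ K, a ∈ T → a = 0)
    (hhom : ∀ k ∈ K, ∀ a : ℕ, a ≤ M → (2 : ℤ) ^ a • k = 0 → ∃ k' ∈ K, k = (2 : ℤ) ^ (M - a) • k')
    {y : B} (hTy : ∀ t ∈ T, f t y = 0) {b : ℕ} (hKy : ∀ k ∈ K, (2 : ℤ) ^ b • f k y = 0)
    {x : A} {a : ℕ} (ha : (2 : ℤ) ^ a • x ∈ T) :
    (2 : ℤ) ^ (a + b - M) • f x y = 0 := by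
  obtain ⟨k, hk, t, ht, rfl⟩ := hKT x
  have hfx : f (k + t) y = f k y := by rw [map_add, AddMonoidHom.add_apply, hTy t ht, add_zero]
  rw [hfx]
  rcases le_or_gt a M with haM | hMa
  · -- `2^a k ∈ K ∩ T = 0`
    have hak : (2 : ℤ) ^ a • k = 0 := by
      apply hdisj _ (K.zsmul_mem hk _)
      have : (2 : ℤ) ^ a • k = (2 : ℤ) ^ a • (k + t) - (2 : ℤ) ^ a • t := by
        rw [smul_add, add_sub_cancel_right]
      rw [this]
      exact T.sub_mem ha (T.zsmul_mem ht _)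
    obtain ⟨k', hk', rfl⟩ := hhom k hk a haM hak
    rw [map_zsmul, AddMonoidHom.zsmul_apply, smul_smul]
    rcases le_or_gt M (a + b) with hMab | habM
    · rw [show (2 : ℤ) ^ (a + b - M) * 2 ^ (M - a) = 2 ^ b by rw [← pow_add]; congr 1; omega]
      exact hKy k' hk'
    · rw [show (2 : ℤ) ^ (a + b - M) * 2 ^ (M - a) = 2 ^ (M - a - b) * 2 ^ b by
        rw [← pow_add, ← pow_add]; congr 1; omega, mul_smul, hKy k' hk', smul_zero]
  · rw [show a + b - M = (a - M) + b by omega, pow_add, mul_smul, hKy k hk, smul_zero]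

end Summit.BirchSwinnertonDyer.BirchSwinnertonDyer.Theorems.KolyvaginLowerBoundAtTwo.SwapPairing
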